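import Literature.NumberTheory.Sieve.HeathBrownCubicTypeIIWeights
import Literature.NumberTheory.Sieve.SieveFrameworkProofs
import Mathlib.Algebra.Order.Chebyshev
import Mathlib.Analysis.PSeries
import HarnessLib

/-!
# Heath-Brown's Lemma 3.10, §13 pp. 81–82: the small moduli `q ≤ Q₀` via hypothesis (3.14)

Support for the proof of **Lemma 3.10** of D. R. Heath-Brown, *Primes represented by `x³ + 2y³`*,
Acta Math. 186 (2001), §13 pp. 81–82:

> "There remains the range `q ≤ Q₀`, where we shall use the hypothesis (3.14). We begin by observing
> that `S(q⁻¹b) = ∑_{c (mod q)} exp{2πi b·c/q} ∑_{β̂ ∈ C, β̂ ≡ c (mod q)} F_β` (13.5). … for `β̂ ∈ C` in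
> (13.5) we have `F_β = f_(β)` for primitive `β̂`, and `F_β = 0` otherwise. It therefore follows that
> `∑_{β̂ ≡ c} F_β = ∑_{β̂ ≡ c} f_(β) ∑_{d ∣ β̂} μ(d) = ∑_d μ(d) ∑_{β̂ ≡ c, d ∣ β̂} f_(β)`, whence
> `S(q⁻¹b) ≪ ∑_{c (mod q)} ∑_d |∑_{β̂ ∈ C, β̂ ≡ c (mod q), d ∣ β̂} f_(β)|` (13.6). The conditions
> `β̂ ≡ c (mod q)` and `d ∣ β̂` confine `β̂` to a single residue class modulo `[q, d]`. The inner sum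
> above is therefore `O(V exp{−c√(log L)})`, by the hypothesis of Lemma 3.10, providing that
> `[q, d] ≤ Q₁`. … For the remaining values of `d` we use the trivial bound `f_(β) ≪ τ(β) log X`."

All statements here are PROVED:

* `Fprim` (the weight `F'_β = f_(β)·[β̂ primitive]`), `isPrimitiveVec_iff_hcf3_eq_one`,
  `Sfrac_Fprim_eq_sum_moebius` (Möbius over `g ∣ β̂`);
* `filter_dvd_red_eq` (the set `{β̂ ∈ C : g ∣ β̂, β̂ ≡ c (q)}` is empty or one class mod `lcm(g, q)`),
  `abs_inner_le_of_hyp` (hypothesis (3.14) for it), `norm_Ag_le` (`|A_g| ≤ q³ H`);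
* the tail in `g`: `sum_filter_dvd_tau_le` — **Hölder with exponent 3** in place of the paper's
  pointwise divisor bound: `∑_{β̂ ∈ C, g ∣ β̂} τ(β) ≤ (S₀/g + 1)² (∑_{β̂ ∈ C} τ(β)³)^{1/3}`;
* **`norm_Sfrac_Fprim_le`**: `|S(b/q; C)| ≤ q³ G · C₁Ve^{−c₁√log L} + 9 S₃^{1/3} ∑_{G < g ≤ M} (S₀/g + 1)²`
  and `sum_Ioc_sq_le`: `∑_{G < g ≤ M} (S₀/g + 1)² ≤ 2S₀²/G + 2S₀(1 + log M) + M`.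

## References

* D. R. Heath-Brown, *Primes represented by `x³ + 2y³`*, Acta Math. 186 (2001), §13 (13.5)–(13.6),
  pp. 81–82. [cite: HeathBrownActa2001, §13 pp. 81–82]

## Mathlib / tree search

Tree: `HeathBrownCubicTypeII` (`latticeCube`, `swSum`, `Hyp314`, `CubeCond`, `fWeight`),
`HeathBrownCubicTypeIIWeightBounds` (`abs_fWeight_le`), `HeathBrownCubicLatticeCount`
(`card_latticeCube_filter_le`, `cubeMod`, `coordElt_sub`), `HeathBrownCubicTypeIIGenerators`
(`intCast_dvd_coordElt_iff`), `HeathBrownCubicTypeIICharSum` (`Sfrac`, `resVecs`, `redVec`),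
`SieveFrameworkProofs` (`sum_divisors_moebius_real`). Mathlib: `pow_sum_le_card_mul_sum_pow`,
`sum_Ioo_inv_sq_le`, `harmonic_le_one_add_log`.
-/

noncomputable section

open Finset NumberField

open scoped ArithmeticFunction.Moebius

namespace Literature.NumberTheory.Sieve.CubicSieve

open LFunctions.CubeRootTwoField CubicPrimes LargeSieve

/-! ### The weight `F'` and Möbius over `g ∣ β̂` -/

section Defs

variable (X τ : ℝ) {k : ℕ} (m : Fin k → ℕ)

open scoped Classical in
/-- **`F'_β = f_(β) · [β̂ primitive]`** (§12 p. 75 / §13 p. 82). [cite: HeathBrownActa2001, §13 p. 82] -/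
def Fprim (v : ℤ × ℤ × ℤ) : ℝ := if IsPrimitiveVec v then fWeight X τ m (Ideal.span {coordElt v}) else 0

end Defs

/-- Primitivity is `h.c.f. = 1`. [folklore] -/
theorem isPrimitiveVec_iff_hcf3_eq_one (v : ℤ × ℤ × ℤ) : IsPrimitiveVec v ↔ hcf3 v = 1 := by
  constructor
  · intro h
    obtain ⟨h1, h2, h3⟩ := hcf3_dvd v
    have hu := h _ h1 h2 h3
    have := Int.isUnit_iff_natAbs_eq.mp hu
    simpa using this
  · intro h d h1 h2 h3
    have hd := dvd_hcf3 ⟨h1, h2, h3⟩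
    rw [h, Nat.cast_one] at hd
    exact isUnit_of_dvd_one hd

/-- `g ∣ hcf3 v ↔ g ∣ v` (componentwise). [folklore] -/
theorem natCast_dvd_hcf3_iff (g : ℕ) (v : ℤ × ℤ × ℤ) : g ∣ hcf3 v ↔ DvdVec (g : ℤ) v := by
  constructor
  · intro h
    have h' : (g : ℤ) ∣ (hcf3 v : ℤ) := by exact_mod_cast h
    obtain ⟨h1, h2, h3⟩ := hcf3_dvd v
    exact ⟨h'.trans h1, h'.trans h2, h'.trans h3⟩
  · intro h
    exact_mod_cast dvd_hcf3 h

open scoped Classical in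
/-- `[β̂ primitive] = ∑_{g ∣ h.c.f.(β̂)} μ(g)` (also for `β̂ = 0`, both sides being `0`). [folklore] -/
theorem indicator_prim_eq_sum_moebius (v : ℤ × ℤ × ℤ) :
    (if IsPrimitiveVec v then (1 : ℝ) else 0) = ∑ g ∈ (hcf3 v).divisors, (μ g : ℝ) := by
  rw [Literature.NumberTheory.Sieve.sum_divisors_moebius_real]
  by_cases h : hcf3 v = 1
  · rw [if_pos ((isPrimitiveVec_iff_hcf3_eq_one v).mpr h), if_pos h]
  · rw [if_neg (fun hp => h ((isPrimitiveVec_iff_hcf3_eq_one v).mp hp)), if_neg h]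

section Main

variable {X τ : ℝ} {k : ℕ} {m : Fin k → ℕ}

open scoped Classical in
/-- The inner sums `A_g = ∑_{β̂ ∈ C, g ∣ β̂} f_(β) e(b·β̂/q)`. [cite: HeathBrownActa2001, §13 (13.6)] -/
def Ag (X τ : ℝ) (m : Fin k → ℕ) (C : Finset (ℤ × ℤ × ℤ)) (q : ℕ) (b : ℤ × ℤ × ℤ) (g : ℕ) : ℂ :=
  ∑ v ∈ C.filter (fun v => DvdVec (g : ℤ) v),
    (fWeight X τ m (Ideal.span {coordElt v}) : ℂ) * LargeSieve.e ((dot3 b v : ℤ) / (q : ℝ))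

open scoped Classical in
/-- **Möbius over `g ∣ β̂`**: `S(b/q; C) = ∑_{g ≤ M} μ(g) A_g` when every `β̂ ∈ C` is nonzero with
`h.c.f.(β̂) ≤ M`. [cite: HeathBrownActa2001, §13 (13.6)] -/
theorem Sfrac_Fprim_eq_sum_moebius {C : Finset (ℤ × ℤ × ℤ)} (hC0 : ∀ v ∈ C, v ≠ 0) {M : ℕ}
    (hM : ∀ v ∈ C, hcf3 v ≤ M) (q : ℕ) (b : ℤ × ℤ × ℤ) :
    Sfrac (Fprim X τ m) C q b = ∑ g ∈ Icc 1 M, (μ g : ℂ) * Ag X τ m C q b g := by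
  classical
  -- expand `F'`
  have hF : ∀ v ∈ C, (Fprim X τ m v : ℂ) =
      (∑ g ∈ (Icc 1 M).filter (fun g : ℕ => DvdVec (g : ℤ) v), (μ g : ℂ)) *
        (fWeight X τ m (Ideal.span {coordElt v}) : ℂ) := by
    intro v hv
    have hdiv : (hcf3 v).divisors = (Icc 1 M).filter (fun g : ℕ => DvdVec (g : ℤ) v) := by
      ext g
      rw [Nat.mem_divisors, mem_filter, mem_Icc, ← natCast_dvd_hcf3_iff]
      have h0 : hcf3 v ≠ 0 := fun h => hC0 v hv ((hcf3_eq_zero_iff v).mp h)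
      constructor
      · rintro ⟨hd, -⟩
        exact ⟨⟨Nat.pos_of_dvd_of_pos hd (Nat.pos_of_ne_zero h0), (Nat.le_of_dvd (Nat.pos_of_ne_zero h0) hd).trans (hM v hv)⟩, hd⟩
      · rintro ⟨-, hd⟩; exact ⟨hd, h0⟩
    have hind := indicator_prim_eq_sum_moebius v
    rw [hdiv] at hind
    rw [Fprim]
    split_ifs with hp
    · rw [if_pos hp] at hind
      have : (∑ g ∈ (Icc 1 M).filter (fun g : ℕ => DvdVec (g : ℤ) v), (μ g : ℂ)) = 1 := by
        have h := congrArg (fun x : ℝ => (x : ℂ)) hind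
        push_cast at h
        exact h.symm
      rw [this, one_mul]
    · rw [if_neg hp] at hind
      have : (∑ g ∈ (Icc 1 M).filter (fun g : ℕ => DvdVec (g : ℤ) v), (μ g : ℂ)) = 0 := by
        have h := congrArg (fun x : ℝ => (x : ℂ)) hind
        push_cast at h
        exact h.symm
      rw [this, zero_mul]; simp
  calc Sfrac (Fprim X τ m) C q b
      = ∑ v ∈ C, (∑ g ∈ (Icc 1 M).filter (fun g : ℕ => DvdVec (g : ℤ) v), (μ g : ℂ)) *
          ((fWeight X τ m (Ideal.span {coordElt v}) : ℂ) * LargeSieve.e ((dot3 b v : ℤ) / (q : ℝ))) := by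
        rw [Sfrac]
        refine sum_congr rfl fun v hv => ?_
        rw [hF v hv]; ring
    _ = ∑ v ∈ C, ∑ g ∈ Icc 1 M, (if DvdVec (g : ℤ) v then (μ g : ℂ) *
          ((fWeight X τ m (Ideal.span {coordElt v}) : ℂ) * LargeSieve.e ((dot3 b v : ℤ) / (q : ℝ))) else 0) := by
        refine sum_congr rfl fun v _ => ?_
        rw [sum_filter, sum_mul]
        refine sum_congr rfl fun g _ => ?_
        split_ifs <;> simp
    _ = ∑ g ∈ Icc 1 M, ∑ v ∈ C, (if DvdVec (g : ℤ) v then (μ g : ℂ) *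
          ((fWeight X τ m (Ideal.span {coordElt v}) : ℂ) * LargeSieve.e ((dot3 b v : ℤ) / (q : ℝ))) else 0) :=
        Finset.sum_comm
    _ = ∑ g ∈ Icc 1 M, (μ g : ℂ) * Ag X τ m C q b g := by
        refine sum_congr rfl fun g _ => ?_
        rw [Ag, sum_filter, mul_sum]
        refine sum_congr rfl fun v _ => ?_
        split_ifs <;> simp

/-! ### The congruence classes: `{β̂ ∈ C : g ∣ β̂, β̂ ≡ c (mod q)}` -/

/-- `lcm(g, q) ∣ x` from `g ∣ x`, `q ∣ x` (integers). [folklore] -/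
theorem natLcm_dvd_of_dvd {g q : ℕ} {x : ℤ} (hg : (g : ℤ) ∣ x) (hq : (q : ℤ) ∣ x) : ((Nat.lcm g q : ℕ) : ℤ) ∣ x := by
  rw [Int.natCast_dvd] at hg hq ⊢
  exact Nat.lcm_dvd hg hq

open scoped Classical in
/-- **One residue class modulo `[q, g]`**: if `v₀ ∈ C` has `g ∣ v₀` and reduction `c` mod `q`, then
`{β̂ ∈ C : g ∣ β̂, red_q(β̂) = c} = {β̂ ∈ C : lcm(g,q) ∣ β̂ − v₀}`. [cite: HeathBrownActa2001, §13 p. 82] -/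
theorem filter_dvd_red_eq {C : Finset (ℤ × ℤ × ℤ)} {g q : ℕ} (hq : 0 < q) {v₀ : ℤ × ℤ × ℤ}
    (hg0 : DvdVec (g : ℤ) v₀) :
    C.filter (fun v => DvdVec (g : ℤ) v ∧ redVec q v = redVec q v₀) =
      C.filter (fun v => DvdVec ((Nat.lcm g q : ℕ) : ℤ) (v - v₀)) := by
  classical
  ext v
  simp only [mem_filter, and_congr_right_iff]
  intro _
  constructor
  · rintro ⟨hgv, hred⟩
    have hgd : DvdVec (g : ℤ) (v - v₀) := by
      have e1 : v - v₀ = v + -v₀ := sub_eq_add_neg v v₀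
      rw [e1]; exact dvdVec_add hgv (dvdVec_neg hg0)
    have hqd : DvdVec (q : ℤ) (v - v₀) := by
      have h1 := dvdVec_sub_redVec q v
      have h2 := dvdVec_sub_redVec q v₀
      rw [hred] at h1
      have e1 : v - v₀ = (v - redVec q v₀) + -(v₀ - redVec q v₀) := by abel
      rw [e1]; exact dvdVec_add h1 (dvdVec_neg h2)
    exact ⟨natLcm_dvd_of_dvd hgd.1 hqd.1, natLcm_dvd_of_dvd hgd.2.1 hqd.2.1, natLcm_dvd_of_dvd hgd.2.2 hqd.2.2⟩
  · intro hl
    have hgl : (g : ℤ) ∣ ((Nat.lcm g q : ℕ) : ℤ) := by exact_mod_cast Nat.dvd_lcm_left g q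
    have hql : (q : ℤ) ∣ ((Nat.lcm g q : ℕ) : ℤ) := by exact_mod_cast Nat.dvd_lcm_right g q
    have hgd : DvdVec (g : ℤ) (v - v₀) := ⟨hgl.trans hl.1, hgl.trans hl.2.1, hgl.trans hl.2.2⟩
    have hqd : DvdVec (q : ℤ) (v - v₀) := ⟨hql.trans hl.1, hql.trans hl.2.1, hql.trans hl.2.2⟩
    refine ⟨?_, ?_⟩
    · have e1 : v = (v - v₀) + v₀ := by abel
      rw [e1]; exact dvdVec_add hgd hg0
    · -- both reductions lie in `resVecs q` and are congruent
      refine eq_of_dvdVec_sub (redVec_mem hq v) (redVec_mem hq v₀) ?_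
      have h1 := dvdVec_sub_redVec q v
      have h2 := dvdVec_sub_redVec q v₀
      have e1 : redVec q v - redVec q v₀ = -(v - redVec q v) + (v - v₀) + (v₀ - redVec q v₀) := by abel
      rw [e1]; exact dvdVec_add (dvdVec_add (dvdVec_neg h1) hqd) h2

open scoped Classical in
/-- The congruence-class sum is a `swSum` of hypothesis (3.14). [cite: HeathBrownActa2001, §13 p. 82] -/
theorem sum_filter_lcm_eq_swSum (a : ℝ × ℝ × ℝ) (S₀ : ℝ) (ℓ : ℕ) (v₀ : ℤ × ℤ × ℤ) :
    ∑ v ∈ (latticeCube a S₀).filter (fun v => DvdVec (ℓ : ℤ) (v - v₀)), fWeight X τ m (Ideal.span {coordElt v}) =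
      swSum X τ m ℓ (coordElt v₀) a S₀ := by
  classical
  rw [swSum]
  refine sum_congr ?_ fun _ _ => rfl
  ext v
  simp only [mem_filter, and_congr_right_iff]
  intro _
  rw [← coordElt_sub, show ((ℓ : ℕ) : 𝓞 K) = ((ℓ : ℤ) : 𝓞 K) by norm_cast, intCast_dvd_coordElt_iff]

open scoped Classical in
/-- **`|A_g| ≤ q³ · C₁ V e^{−c₁√(log L)}`** for `1 ≤ g`, `gq ≤ Q₁`, on a cube satisfying the conditions
of (3.14). [cite: HeathBrownActa2001, §13 p. 82] -/
theorem norm_Ag_le {Q₁ C₁ c₁ c₃ c₄ : ℝ} (hHyp : Hyp314 X τ m Q₁ C₁ c₁ c₃ c₄) {V : ℝ} (hV : 0 < V)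
    {a : ℝ × ℝ × ℝ} {S₀ : ℝ} (hs : hbL X τ ^ 2 ≤ S₀) (hcube : CubeCond c₃ c₄ V a S₀)
    {q : ℕ} (hq : 1 ≤ q) {g : ℕ} (hg : 1 ≤ g) (hgq : ((g * q : ℕ) : ℝ) ≤ Q₁) (b : ℤ × ℤ × ℤ) :
    ‖Ag X τ m (latticeCube a S₀) q b g‖ ≤
      (q : ℝ) ^ 3 * (C₁ * V * Real.exp (-(c₁ * Real.sqrt (Real.log (hbL X τ))))) := by
  classical
  set C := latticeCube a S₀ with hC
  set H : ℝ := C₁ * V * Real.exp (-(c₁ * Real.sqrt (Real.log (hbL X τ)))) with hH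
  set ℓ : ℕ := Nat.lcm g q with hℓ
  have hℓ1 : 1 ≤ ℓ := Nat.pos_of_ne_zero (Nat.lcm_ne_zero (by omega) (by omega))
  have hℓQ : (ℓ : ℝ) ≤ Q₁ := le_trans (by exact_mod_cast Nat.lcm_le_mul (by omega) (by omega)) hgq
  have hqpos : 0 < q := by omega
  have hH0 : 0 ≤ H := by
    -- from the hypothesis applied to any admissible data the bound is `≥ |·| ≥ 0`
    have := hHyp ℓ hℓ1 hℓQ 0 V a S₀ hV hs hcube
    exact (abs_nonneg _).trans this
  -- group by the residue `c = red_q(v)`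
  have hphase : ∀ v : ℤ × ℤ × ℤ, LargeSieve.e ((dot3 b v : ℤ) / (q : ℝ)) =
      LargeSieve.e ((dot3 b (redVec q v) : ℤ) / (q : ℝ)) := by
    intro v
    obtain ⟨⟨k1, hk1⟩, ⟨k2, hk2⟩, ⟨k3, hk3⟩⟩ := dvdVec_sub_redVec q v
    simp only [Prod.fst_sub, Prod.snd_sub] at hk1 hk2 hk3
    have : dot3 b v = dot3 b (redVec q v) + (q : ℤ) * (b.1 * k1 + b.2.1 * k2 + b.2.2 * k3) := by
      simp only [dot3]; linear_combination b.1 * hk1 + b.2.1 * hk2 + b.2.2 * hk3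
    rw [this, Int.cast_add, add_div]
    have hq0 : (q : ℝ) ≠ 0 := by exact_mod_cast hqpos.ne'
    have : (((q : ℤ) * (b.1 * k1 + b.2.1 * k2 + b.2.2 * k3) : ℤ) : ℝ) / q =
        ((b.1 * k1 + b.2.1 * k2 + b.2.2 * k3 : ℤ) : ℝ) := by push_cast; field_simp
    rw [this, e_add_int]
  set A := C.filter (fun v => DvdVec (g : ℤ) v) with hA
  have hmaps : ∀ v ∈ A, redVec q v ∈ resVecs q := fun v _ => redVec_mem hqpos v
  have hsplit : Ag X τ m C q b g = ∑ c ∈ resVecs q, LargeSieve.e ((dot3 b c : ℤ) / (q : ℝ)) *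
      ∑ v ∈ A.filter (fun v => redVec q v = c), (fWeight X τ m (Ideal.span {coordElt v}) : ℂ) := by
    rw [Ag, ← hA, ← sum_fiberwise_of_maps_to hmaps]
    refine sum_congr rfl fun c _ => ?_
    rw [mul_sum]
    refine sum_congr rfl fun v hv => ?_
    rw [mem_filter] at hv
    rw [hphase v, hv.2]; ring
  -- each inner sum is a `swSum` with modulus `ℓ ≤ Q₁`, or empty
  have hinner : ∀ c ∈ resVecs q,
      ‖∑ v ∈ A.filter (fun v => redVec q v = c), (fWeight X τ m (Ideal.span {coordElt v}) : ℂ)‖ ≤ H := by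
    intro c _
    by_cases hempty : A.filter (fun v => redVec q v = c) = ∅
    · rw [hempty, sum_empty, norm_zero]; exact hH0
    obtain ⟨v₀, hv₀⟩ := nonempty_iff_ne_empty.mpr hempty
    rw [mem_filter, hA, mem_filter] at hv₀
    obtain ⟨⟨-, hg0⟩, hc0⟩ := hv₀
    have hset : A.filter (fun v => redVec q v = c) = C.filter (fun v => DvdVec (ℓ : ℤ) (v - v₀)) := by
      rw [hA, filter_filter, ← hc0, hℓ]
      exact filter_dvd_red_eq hqpos hg0
    rw [hset, hC]
    have hreal : (∑ v ∈ (latticeCube a S₀).filter (fun v => DvdVec (ℓ : ℤ) (v - v₀)),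
        (fWeight X τ m (Ideal.span {coordElt v}) : ℂ)) = ((swSum X τ m ℓ (coordElt v₀) a S₀ : ℝ) : ℂ) := by
      rw [← sum_filter_lcm_eq_swSum]; push_cast; rfl
    rw [hreal, Complex.norm_real, Real.norm_eq_abs]
    exact hHyp ℓ hℓ1 hℓQ (coordElt v₀) V a S₀ hV hs hcube
  rw [hsplit]
  calc ‖∑ c ∈ resVecs q, LargeSieve.e ((dot3 b c : ℤ) / (q : ℝ)) *
          ∑ v ∈ A.filter (fun v => redVec q v = c), (fWeight X τ m (Ideal.span {coordElt v}) : ℂ)‖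
      ≤ ∑ c ∈ resVecs q, ‖LargeSieve.e ((dot3 b c : ℤ) / (q : ℝ)) *
          ∑ v ∈ A.filter (fun v => redVec q v = c), (fWeight X τ m (Ideal.span {coordElt v}) : ℂ)‖ :=
        norm_sum_le _ _
    _ ≤ ∑ _c ∈ resVecs q, H := by
        refine sum_le_sum fun c hc => ?_
        rw [norm_mul, norm_e, one_mul]
        exact hinner c hc
    _ = (q : ℝ) ^ 3 * H := by rw [sum_const, card_resVecs, nsmul_eq_mul]; push_cast; ring

/-! ### The tail in `g`: Hölder with exponent 3 -/

open scoped Classical in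
/-- `#{β̂ ∈ C : g ∣ β̂} ≤ (S₀/g + 1)³` for a lattice cube of side `S₀ ≥ 0`. [folklore] -/
theorem card_filter_dvdVec_le {g : ℕ} (hg : 1 ≤ g) (a : ℝ × ℝ × ℝ) {S₀ : ℝ} (hS : 0 ≤ S₀) :
    (#((latticeCube a S₀).filter (fun v => DvdVec (g : ℤ) v)) : ℝ) ≤ (S₀ / g + 1) ^ 3 := by
  classical
  have h := card_latticeCube_filter_le (m := g) (by omega) (fun v => DvdVec (g : ℤ) v)
    (fun v t => ?_) a hS
  · refine h.trans ?_
    have hone : #((cubeMod g).filter (fun v => DvdVec (g : ℤ) v)) ≤ 1 := by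
      rw [card_le_one]
      intro x hx y hy
      rw [mem_filter] at hx hy
      have key : ∀ z : ℤ × ℤ × ℤ, z ∈ cubeMod g → DvdVec (g : ℤ) z → z = 0 := by
        intro z hz hd
        rw [cubeMod, mem_product, mem_product, mem_Ico, mem_Ico, mem_Ico] at hz
        obtain ⟨d1, d2, d3⟩ := hd
        have e1 : z.1 = 0 := by
          have := Int.eq_zero_of_abs_lt_dvd d1 (by rw [abs_lt]; constructor <;> omega); exact this
        have e2 : z.2.1 = 0 := by
          have := Int.eq_zero_of_abs_lt_dvd d2 (by rw [abs_lt]; constructor <;> omega); exact this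
        have e3 : z.2.2 = 0 := by
          have := Int.eq_zero_of_abs_lt_dvd d3 (by rw [abs_lt]; constructor <;> omega); exact this
        exact Prod.ext e1 (Prod.ext e2 e3)
      rw [key x hx.1 hx.2, key y hy.1 hy.2]
    have : (#((cubeMod g).filter (fun v => DvdVec (g : ℤ) v)) : ℝ) ≤ 1 := by exact_mod_cast hone
    have h0 : 0 ≤ (S₀ / g + 1) ^ 3 := by positivity
    nlinarith
  · -- periodicity
    constructor
    · intro h
      have e1 : v = (v + (g : ℤ) • t) + -((g : ℤ) • t) := by abel
      rw [e1]; exact dvdVec_add h (dvdVec_neg (dvdVec_smul_of_dvd (dvd_refl _) t))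
    · intro h; exact dvdVec_add h (dvdVec_smul_of_dvd (dvd_refl _) t)

open scoped Classical in
/-- **Hölder (exponent 3)**: `∑_{β̂ ∈ C, g ∣ β̂} τ(β) ≤ (S₀/g + 1)² (∑_{β̂ ∈ C} τ(β)³)^{1/3}`.
[cite: HeathBrownActa2001, §13 p. 82] -/
theorem sum_filter_dvd_tau_le {g : ℕ} (hg : 1 ≤ g) (a : ℝ × ℝ × ℝ) {S₀ : ℝ} (hS : 0 ≤ S₀) :
    ∑ v ∈ (latticeCube a S₀).filter (fun v => DvdVec (g : ℤ) v), (idealDivisorCount (Ideal.span {coordElt v}) : ℝ) ≤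
      (S₀ / g + 1) ^ 2 *
        (∑ v ∈ latticeCube a S₀, (idealDivisorCount (Ideal.span {coordElt v}) : ℝ) ^ 3) ^ (1 / 3 : ℝ) := by
  classical
  set A := (latticeCube a S₀).filter (fun v => DvdVec (g : ℤ) v) with hA
  set tK : ℤ × ℤ × ℤ → ℝ := fun v => (idealDivisorCount (Ideal.span {coordElt v}) : ℝ) with htK
  set S₃ : ℝ := ∑ v ∈ latticeCube a S₀, tK v ^ 3 with hS₃
  have htK0 : ∀ v, 0 ≤ tK v := fun v => Nat.cast_nonneg _
  have hT0 : 0 ≤ ∑ v ∈ A, tK v := sum_nonneg fun v _ => htK0 v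
  have hS₃0 : 0 ≤ S₃ := sum_nonneg fun v _ => by positivity
  -- `(∑_A τ)³ ≤ #A² ∑_A τ³ ≤ (S₀/g+1)⁶ S₃`
  have hjensen : (∑ v ∈ A, tK v) ^ 3 ≤ (#A : ℝ) ^ 2 * ∑ v ∈ A, tK v ^ 3 :=
    pow_sum_le_card_mul_sum_pow (s := A) (f := tK) (fun v _ => htK0 v) 2
  have hA3 : ∑ v ∈ A, tK v ^ 3 ≤ S₃ :=
    sum_le_sum_of_subset_of_nonneg (filter_subset _ _) fun v _ _ => by positivity
  have hcard := card_filter_dvdVec_le hg a hS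
  rw [← hA] at hcard
  have hB0 : 0 ≤ S₀ / g + 1 := by positivity
  have hA30 : 0 ≤ ∑ v ∈ A, tK v ^ 3 := sum_nonneg fun v _ => by positivity
  have hcube : (∑ v ∈ A, tK v) ^ 3 ≤ (S₀ / g + 1) ^ 6 * S₃ := by
    calc (∑ v ∈ A, tK v) ^ 3 ≤ (#A : ℝ) ^ 2 * ∑ v ∈ A, tK v ^ 3 := hjensen
      _ ≤ ((S₀ / g + 1) ^ 3) ^ 2 * S₃ :=
          mul_le_mul (pow_le_pow_left₀ (Nat.cast_nonneg _) hcard 2) hA3 hA30 (by positivity)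
      _ = (S₀ / g + 1) ^ 6 * S₃ := by ring
  -- take cube roots
  have h3 : (∑ v ∈ A, tK v) = ((∑ v ∈ A, tK v) ^ 3) ^ (1 / 3 : ℝ) := by
    rw [← Real.rpow_natCast, ← Real.rpow_mul hT0]; norm_num
  rw [h3]
  calc ((∑ v ∈ A, tK v) ^ 3) ^ (1 / 3 : ℝ) ≤ ((S₀ / g + 1) ^ 6 * S₃) ^ (1 / 3 : ℝ) :=
        Real.rpow_le_rpow (by positivity) hcube (by norm_num)
    _ = ((S₀ / g + 1) ^ 6) ^ (1 / 3 : ℝ) * S₃ ^ (1 / 3 : ℝ) := Real.mul_rpow (by positivity) hS₃0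
    _ = (S₀ / g + 1) ^ 2 * S₃ ^ (1 / 3 : ℝ) := by
        congr 1
        rw [← Real.rpow_natCast, ← Real.rpow_mul hB0]; norm_num

/-! ### The bound for `S(b/q; C)` -/

open scoped Classical in
/-- **The small-`q` bound**: for a lattice cube `C` of side `S₀` satisfying the conditions of (3.14)
(`CubeCond`, `S₀ ≥ L²`) whose points are nonzero with `h.c.f. ≤ M`, and `q ≥ 1`, `G ≥ 1` with `qG ≤ Q₁`:
`|S(b/q; C)| ≤ q³ G · C₁Ve^{−c₁√log L} + 9 S₃^{1/3} ∑_{G < g ≤ M} (S₀/g + 1)²` (`|f| ≤ 9τ`, Hölder).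
[cite: HeathBrownActa2001, §13 pp. 81–82] -/
theorem norm_Sfrac_Fprim_le (hX : 1 < X) (hτ : 0 < τ) (hτ1 : τ ≤ 1) {n : ℕ} {m : Fin (n + 1) → ℕ}
    (hm : CoreAdmissible τ m) {Q₁ C₁ c₁ c₃ c₄ : ℝ} (hHyp : Hyp314 X τ m Q₁ C₁ c₁ c₃ c₄) {V : ℝ} (hV : 0 < V)
    {a : ℝ × ℝ × ℝ} {S₀ : ℝ} (hS : 0 ≤ S₀) (hs : hbL X τ ^ 2 ≤ S₀) (hcube : CubeCond c₃ c₄ V a S₀)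
    (hC0 : ∀ v ∈ latticeCube a S₀, v ≠ 0) {M : ℕ} (hM : ∀ v ∈ latticeCube a S₀, hcf3 v ≤ M)
    {q : ℕ} (hq : 1 ≤ q) {G : ℝ} (hG : 1 ≤ G) (hqG : (q : ℝ) * G ≤ Q₁) (b : ℤ × ℤ × ℤ) :
    ‖Sfrac (Fprim X τ m) (latticeCube a S₀) q b‖ ≤
      (q : ℝ) ^ 3 * G * (C₁ * V * Real.exp (-(c₁ * Real.sqrt (Real.log (hbL X τ))))) +
        9 * (∑ v ∈ latticeCube a S₀, (idealDivisorCount (Ideal.span {coordElt v}) : ℝ) ^ 3) ^ (1 / 3 : ℝ) *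
          ∑ g ∈ Ioc ⌊G⌋₊ M, (S₀ / g + 1) ^ 2 := by
  classical
  set C := latticeCube a S₀ with hC
  set H : ℝ := C₁ * V * Real.exp (-(c₁ * Real.sqrt (Real.log (hbL X τ)))) with hH
  set S₃ : ℝ := ∑ v ∈ latticeCube a S₀, (idealDivisorCount (Ideal.span {coordElt v}) : ℝ) ^ 3 with hS₃
  have hS₃0 : 0 ≤ S₃ := sum_nonneg fun v _ => by positivity
  have hH0 : 0 ≤ H := by
    have h1 : (1 : ℝ) ≤ Q₁ := by
      have : (q : ℝ) * G ≥ 1 * 1 := mul_le_mul (by exact_mod_cast hq) hG zero_le_one (by positivity)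
      linarith
    have := hHyp 1 le_rfl (by simpa using h1) 0 V a S₀ hV hs hcube
    exact (abs_nonneg _).trans this
  rw [Sfrac_Fprim_eq_sum_moebius hC0 hM q b]
  -- split at `⌊G⌋₊`
  set Gn : ℕ := ⌊G⌋₊ with hGn
  have hGn1 : 1 ≤ Gn := by rw [hGn]; exact Nat.le_floor (by exact_mod_cast hG)
  rw [← sum_filter_add_sum_filter_not (Icc 1 M) (fun g => g ≤ Gn)]
  refine (norm_add_le _ _).trans (add_le_add ?_ ?_)
  · -- small `g`
    calc ‖∑ g ∈ (Icc 1 M).filter (fun g => g ≤ Gn), (μ g : ℂ) * Ag X τ m C q b g‖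
        ≤ ∑ g ∈ (Icc 1 M).filter (fun g => g ≤ Gn), ‖(μ g : ℂ) * Ag X τ m C q b g‖ := norm_sum_le _ _
      _ ≤ ∑ g ∈ (Icc 1 M).filter (fun g => g ≤ Gn), (q : ℝ) ^ 3 * H := by
          refine sum_le_sum fun g hg => ?_
          rw [mem_filter, mem_Icc] at hg
          have hμ : ‖(μ g : ℂ)‖ ≤ 1 := by
            have := ArithmeticFunction.abs_moebius_le_one (n := g)
            rw [Complex.norm_intCast]; exact_mod_cast this
          have hgq : ((g * q : ℕ) : ℝ) ≤ Q₁ := by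
            have hgG : (g : ℝ) ≤ G := by
              have : (g : ℝ) ≤ Gn := by exact_mod_cast hg.2
              exact this.trans (Nat.floor_le (by linarith))
            calc ((g * q : ℕ) : ℝ) = (q : ℝ) * g := by push_cast; ring
              _ ≤ (q : ℝ) * G := by gcongr
              _ ≤ Q₁ := hqG
          have hA := norm_Ag_le hHyp hV hs hcube hq hg.1.1 hgq b
          rw [norm_mul]
          calc ‖(μ g : ℂ)‖ * ‖Ag X τ m C q b g‖ ≤ 1 * ((q : ℝ) ^ 3 * H) :=
                mul_le_mul hμ hA (norm_nonneg _) zero_le_one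
            _ = (q : ℝ) ^ 3 * H := one_mul _
      _ = #((Icc 1 M).filter (fun g => g ≤ Gn)) * ((q : ℝ) ^ 3 * H) := by rw [sum_const, nsmul_eq_mul]
      _ ≤ Gn * ((q : ℝ) ^ 3 * H) := by
          gcongr
          have : (Icc 1 M).filter (fun g => g ≤ Gn) ⊆ Icc 1 Gn := by
            intro g hg; rw [mem_filter, mem_Icc] at hg; rw [mem_Icc]; exact ⟨hg.1.1, hg.2⟩
          exact_mod_cast (card_le_card this).trans (by simp)
      _ ≤ G * ((q : ℝ) ^ 3 * H) := by
          gcongr; exact Nat.floor_le (by linarith)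
      _ = (q : ℝ) ^ 3 * G * H := by ring
  · -- large `g`
    calc ‖∑ g ∈ (Icc 1 M).filter (fun g => ¬g ≤ Gn), (μ g : ℂ) * Ag X τ m C q b g‖
        ≤ ∑ g ∈ (Icc 1 M).filter (fun g => ¬g ≤ Gn), ‖(μ g : ℂ) * Ag X τ m C q b g‖ := norm_sum_le _ _
      _ ≤ ∑ g ∈ (Icc 1 M).filter (fun g => ¬g ≤ Gn), 9 * S₃ ^ (1 / 3 : ℝ) * (S₀ / g + 1) ^ 2 := by
          refine sum_le_sum fun g hg => ?_
          rw [mem_filter, mem_Icc] at hg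
          have hg1 : 1 ≤ g := hg.1.1
          have hμ : ‖(μ g : ℂ)‖ ≤ 1 := by
            have := ArithmeticFunction.abs_moebius_le_one (n := g)
            rw [Complex.norm_intCast]; exact_mod_cast this
          -- `|A_g| ≤ ∑ |f| ≤ 9 ∑ τ ≤ 9 (S₀/g+1)² S₃^{1/3}`
          have hA : ‖Ag X τ m C q b g‖ ≤ 9 * ((S₀ / g + 1) ^ 2 * S₃ ^ (1 / 3 : ℝ)) := by
            calc ‖Ag X τ m C q b g‖
                ≤ ∑ v ∈ C.filter (fun v => DvdVec (g : ℤ) v),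
                    ‖(fWeight X τ m (Ideal.span {coordElt v}) : ℂ) * LargeSieve.e ((dot3 b v : ℤ) / (q : ℝ))‖ :=
                  norm_sum_le _ _
              _ ≤ ∑ v ∈ C.filter (fun v => DvdVec (g : ℤ) v), 9 * (idealDivisorCount (Ideal.span {coordElt v}) : ℝ) := by
                  refine sum_le_sum fun v _ => ?_
                  rw [norm_mul, norm_e, mul_one, Complex.norm_real, Real.norm_eq_abs]
                  exact abs_fWeight_le hX hτ hτ1 hm _
              _ = 9 * ∑ v ∈ C.filter (fun v => DvdVec (g : ℤ) v), (idealDivisorCount (Ideal.span {coordElt v}) : ℝ) := by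
                  rw [mul_sum]
              _ ≤ 9 * ((S₀ / g + 1) ^ 2 * S₃ ^ (1 / 3 : ℝ)) := by
                  gcongr; exact sum_filter_dvd_tau_le hg1 a hS
          rw [norm_mul]
          calc ‖(μ g : ℂ)‖ * ‖Ag X τ m C q b g‖ ≤ 1 * (9 * ((S₀ / g + 1) ^ 2 * S₃ ^ (1 / 3 : ℝ))) :=
                mul_le_mul hμ hA (norm_nonneg _) zero_le_one
            _ = 9 * S₃ ^ (1 / 3 : ℝ) * (S₀ / g + 1) ^ 2 := by ring
      _ = 9 * S₃ ^ (1 / 3 : ℝ) * ∑ g ∈ (Icc 1 M).filter (fun g => ¬g ≤ Gn), (S₀ / g + 1) ^ 2 := by rw [mul_sum]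
      _ ≤ 9 * S₃ ^ (1 / 3 : ℝ) * ∑ g ∈ Ioc Gn M, (S₀ / g + 1) ^ 2 := by
          gcongr
          · intro g hg
            rw [mem_filter, mem_Icc] at hg; rw [mem_Ioc]; omega

/-- **`∑_{G < g ≤ M} (S₀/g + 1)² ≤ 2S₀²/G + 2S₀(1 + log M) + M`** (`G ≥ 1`, `S₀ ≥ 0`). [folklore] -/
theorem sum_Ioc_sq_le {G S₀ : ℝ} (hG : 1 ≤ G) (hS : 0 ≤ S₀) (M : ℕ) :
    ∑ g ∈ Ioc ⌊G⌋₊ M, (S₀ / g + 1) ^ 2 ≤ 2 * S₀ ^ 2 / G + 2 * S₀ * (1 + Real.log M) + M := by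
  have hexp : ∀ g : ℕ, (S₀ / g + 1) ^ 2 = S₀ ^ 2 * (((g : ℕ) : ℝ) ^ 2)⁻¹ + 2 * S₀ * ((g : ℝ))⁻¹ + 1 := by
    intro g; rw [div_eq_mul_inv]; ring
  simp_rw [hexp]
  rw [sum_add_distrib, sum_add_distrib, ← mul_sum, ← mul_sum, sum_const, Nat.card_Ioc, nsmul_eq_mul, mul_one]
  -- `∑ g⁻² ≤ 2/G`
  have h1 : ∑ g ∈ Ioc ⌊G⌋₊ M, (((g : ℕ) : ℝ) ^ 2)⁻¹ ≤ 2 / G := by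
    calc ∑ g ∈ Ioc ⌊G⌋₊ M, (((g : ℕ) : ℝ) ^ 2)⁻¹ ≤ ∑ g ∈ Ioo ⌊G⌋₊ (M + 1), (((g : ℕ) : ℝ) ^ 2)⁻¹ := by
          refine sum_le_sum_of_subset_of_nonneg (fun g hg => ?_) (fun _ _ _ => by positivity)
          rw [mem_Ioc] at hg; rw [mem_Ioo]; omega
      _ ≤ 2 / ((⌊G⌋₊ : ℝ) + 1) := sum_Ioo_inv_sq_le _ _
      _ ≤ 2 / G := by
          apply div_le_div_of_nonneg_left (by norm_num) (by linarith) (Nat.lt_floor_add_one G).le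
  -- `∑ g⁻¹ ≤ 1 + log M`
  have h2 : ∑ g ∈ Ioc ⌊G⌋₊ M, ((g : ℝ))⁻¹ ≤ 1 + Real.log M := by
    have hharm := harmonic_le_one_add_log M
    rw [harmonic_eq_sum_Icc] at hharm
    push_cast at hharm
    refine le_trans ?_ hharm
    refine sum_le_sum_of_subset_of_nonneg (fun g hg => ?_) (fun _ _ _ => by positivity)
    rw [mem_Ioc] at hg; rw [mem_Icc]
    have : 1 ≤ ⌊G⌋₊ := Nat.le_floor (by exact_mod_cast hG)
    omega
  have hM : (((M - ⌊G⌋₊ : ℕ)) : ℝ) ≤ M := by exact_mod_cast Nat.sub_le M ⌊G⌋₊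
  have hS2 : 0 ≤ S₀ ^ 2 := by positivity
  have := mul_le_mul_of_nonneg_left h1 hS2
  have := mul_le_mul_of_nonneg_left h2 (by positivity : 0 ≤ 2 * S₀)
  have e : S₀ ^ 2 * (2 / G) = 2 * S₀ ^ 2 / G := by ring
  linarith

end Main

end Literature.NumberTheory.Sieve.CubicSieve

end
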